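import Summits.SmoothPoincare4.SmoothPoincare4.Theorems.SblfDescentRungOneStubSliceRecognitionAux2
import Literature.Topology.FourManifolds.SphereDiffeoLoops
import Literature.Topology.FourManifolds.SmaleDiffDisc

/-!
# Four-sphere recognition from a slice-preserving genus-one gluing, IV: deforming a circle of
# diffeomorphisms of `S²` to a circle of isometries (Smale 1959, Cerf 1968) — helpers for stub
# `stub_sliceRecognition` of line `Sketch`, crux `SblfDescent.RungOne`

(Crux item stmt-SmoothPoincare4-18531; skeleton `Cruxes/RungOne/Lines/Sketch.lean`.)

A slice-preserving gluing diffeomorphism of `S² × S¹` is a smooth circle-family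
`g : 𝕊¹ × S² → S²` of diffeomorphisms of `S²` (part III).  This file deforms any such family,
through jointly smooth paths of such families (with jointly smooth fibrewise inverses), to a
family of linear isometries `u ↦ A(angA u) ∘ L`, `A` a smooth loop in `O(3)` trivial near the
base point and `L ∈ O(3)`:

* `exists_path_collapse` — **step (a)**: precomposing with the collapsing homotopy `ρ_t` of the
  circle (part II, `helper_sliceRec_rho`) deforms `g` to `u ↦ g (circlePt (β (angA u)))`, a
  family which is CONSTANT (`= g ptA`) near the base point;
* `helper_sliceRec_cerf` (registered helper) — **step (b), Cerf 1968, Appendice §5, Cor. 2 at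
  `i = 1` (`π₁ SO(3) ↠ π₁ Diff S²`, from Smale's theorem in families)**: the based loop
  `s ↦ g (circlePt (smoothTransition s)) ∘ (g ptA)⁻¹`, flat off `(0, 1)`, deforms through based
  loops to its frame loop of rotations (`exists_loopHomotopy_frameLoop_two`); after the affine
  reparametrisation `s = 2a - 1/2` of the angle `a` the two-parameter family is the identity for
  `a ∉ (1/4, 3/4)`, so it descends to the circle (`contMDiff_comp_angA`): the family of step (a)
  deforms to `u ↦ A(angA u) ∘ g ptA`;
* `exists_path_smale` — **step (c), Smale 1959 at `π₀` (Cerf, loc. cit., Cor. 2 at `i = 0`)**: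
  `g ptA` is diffeotopic to the identity or to a reflection
  (`Diffeomorph.isDiffeotopicToId_or_isDiffeotopic_sphereReflection_two`), i.e. to
  `sphereCongr L`, `L ∈ {1, reflection}`; composing the diffeotopy with the rotations deforms
  `u ↦ A(angA u) ∘ g ptA` to `u ↦ A(angA u) ∘ L`.

Everything is proved; no definitions, no named facts, no local notation.

## References

* J. Cerf, *Sur les difféomorphismes de la sphère de dimension trois (Γ₄ = 0)*, LNM 53 (1968),
  Appendice §5, Prop. 4, Théorème 4 (Smale), Corollaire 2. [CerfDiffeoSphere1968]
* S. Smale, *Diffeomorphisms of the 2-sphere*, Proc. AMS 10 (1959) 621–626.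
-/

-- the prescribed namespace `Summit.<P>.<Sub>.…` duplicates `SmoothPoincare4` (P = Sub)
set_option linter.dupNamespace false

noncomputable section

open scoped Manifold ContDiff Topology
open Set Function Literature.Topology.FourManifolds

namespace Summit.SmoothPoincare4.SmoothPoincare4.Cruxes.RungOne.Sketch

/-! ### Step (a): collapsing the family near the base point -/

/-- **Step (a): making a circle-family constant near the base point.**  For a jointly smooth
circle-family `g` of diffeomorphisms of `S²` with jointly smooth fibrewise inverse `g⁻¹`, the
families `H_t u := g (ρ_t u)` (`ρ` the collapsing homotopy of `helper_sliceRec_rho`) form a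
jointly smooth path, with inverses `g⁻¹ (ρ_t u)`, from `H_0 = g` to
`H_1 u = g (circlePt (β (angA u)))`, `β(s) = smoothTransition (2s - 1/2)`.
[cite: CerfDiffeoSphere1968, Ch. I §1] -/
theorem exists_path_collapse
    (g gi : Metric.sphere (0 : EuclideanSpace ℝ (Fin 2)) 1 → Metric.sphere (0 : EuclideanSpace ℝ (Fin 3)) 1 →
      Metric.sphere (0 : EuclideanSpace ℝ (Fin 3)) 1)
    (hg : ContMDiff ((𝓡 1).prod (𝓡 2)) (𝓡 2) ∞ fun p : Metric.sphere (0 : EuclideanSpace ℝ (Fin 2)) 1 ×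
      Metric.sphere (0 : EuclideanSpace ℝ (Fin 3)) 1 => g p.1 p.2)
    (hgi : ContMDiff ((𝓡 1).prod (𝓡 2)) (𝓡 2) ∞ fun p : Metric.sphere (0 : EuclideanSpace ℝ (Fin 2)) 1 ×
      Metric.sphere (0 : EuclideanSpace ℝ (Fin 3)) 1 => gi p.1 p.2)
    (hgig : ∀ u x, gi u (g u x) = x) (hggi : ∀ u x, g u (gi u x) = x) :
    ∃ H Hi : ℝ → Metric.sphere (0 : EuclideanSpace ℝ (Fin 2)) 1 → Metric.sphere (0 : EuclideanSpace ℝ (Fin 3)) 1 →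
        Metric.sphere (0 : EuclideanSpace ℝ (Fin 3)) 1,
      ContMDiff (𝓘(ℝ, ℝ).prod ((𝓡 1).prod (𝓡 2))) (𝓡 2) ∞
        (fun p : ℝ × (Metric.sphere (0 : EuclideanSpace ℝ (Fin 2)) 1 × Metric.sphere (0 : EuclideanSpace ℝ (Fin 3)) 1) =>
          H p.1 p.2.1 p.2.2) ∧
      ContMDiff (𝓘(ℝ, ℝ).prod ((𝓡 1).prod (𝓡 2))) (𝓡 2) ∞
        (fun p : ℝ × (Metric.sphere (0 : EuclideanSpace ℝ (Fin 2)) 1 × Metric.sphere (0 : EuclideanSpace ℝ (Fin 3)) 1) =>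
          Hi p.1 p.2.1 p.2.2) ∧
      (∀ t u x, Hi t u (H t u x) = x) ∧ (∀ t u x, H t u (Hi t u x) = x) ∧
      (∀ u x, H 0 u x = g u x) ∧
      (∀ u x, H 1 u x = g (circlePt (Real.smoothTransition (2 * angA u - 1 / 2))) x) := by
  obtain ⟨ρ, hρ, hρ0, hρ1⟩ := helper_sliceRec_rho
  have hρ' : ContMDiff (𝓘(ℝ, ℝ).prod ((𝓡 1).prod (𝓡 2))) ((𝓡 1).prod (𝓡 2)) ∞
      fun p : ℝ × (Metric.sphere (0 : EuclideanSpace ℝ (Fin 2)) 1 × Metric.sphere (0 : EuclideanSpace ℝ (Fin 3)) 1) =>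
        (ρ p.1 p.2.1, p.2.2) :=
    (hρ.comp (contMDiff_fst.prodMk (contMDiff_fst.comp contMDiff_snd))).prodMk
      (contMDiff_snd.comp contMDiff_snd)
  refine ⟨fun t u x => g (ρ t u) x, fun t u x => gi (ρ t u) x, hg.comp hρ', hgi.comp hρ',
    fun t u x => hgig _ _, fun t u x => hggi _ _, fun u x => ?_, fun u x => ?_⟩
  · show g (ρ 0 u) x = g u x
    rw [hρ0]
  · show g (ρ 1 u) x = _
    rw [hρ1]

/-! ### Step (b): Cerf's deformation of a based loop in `Diff(S²)` to a loop of rotations -/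

/-- **Registered helper `helper_sliceRec_cerf` — step (b): a circle-family of diffeomorphisms
of `S²`, constant near the base point, deforms to a circle of rotations composed with its base
diffeomorphism.**  For `g, g⁻¹` as above there are a smooth loop `A` of linear isometries of
`ℝ³`, equal to `1` for `a ∉ (1/4, 3/4)`, and a jointly smooth path of families (with jointly
smooth fibrewise inverses) from `u ↦ g (circlePt (β (angA u)))` to `u ↦ A(angA u) ∘ g ptA`.
Proof: the based loop `D_s = g (circlePt (smoothTransition s)) ∘ (g ptA)⁻¹` (a `Diffeotopy` of
`S²` by `Diffeotopy.mk'`, the identity for `s ∉ (0, 1)`) deforms through based loops to its frame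
loop (`exists_loopHomotopy_frameLoop_two`: Cerf 1968, Appendice §5, Cor. 2 at `i = 1`, from
Smale's theorem in families); the two-parameter family, reparametrised by `s = 2a - 1/2` and
composed with `g ptA`, is the constant `g ptA` for `a ∉ (1/4, 3/4)` and so descends to the circle
(`contMDiff_comp_angA`). [cite: CerfDiffeoSphere1968, Appendice §5, Corollaire 2] -/
theorem helper_sliceRec_cerf : ∀ g gi : Metric.sphere (0 : EuclideanSpace ℝ (Fin 2)) 1 → Metric.sphere (0 : EuclideanSpace ℝ (Fin 3)) 1 → Metric.sphere (0 : EuclideanSpace ℝ (Fin 3)) 1, ContMDiff ((𝓡 1).prod (𝓡 2)) (𝓡 2) ∞ (fun p : Metric.sphere (0 : EuclideanSpace ℝ (Fin 2)) 1 × Metric.sphere (0 : EuclideanSpace ℝ (Fin 3)) 1 => g p.1 p.2) → ContMDiff ((𝓡 1).prod (𝓡 2)) (𝓡 2) ∞ (fun p : Metric.sphere (0 : EuclideanSpace ℝ (Fin 2)) 1 × Metric.sphere (0 : EuclideanSpace ℝ (Fin 3)) 1 => gi p.1 p.2) → (∀ u x, gi u (g u x) = x) → (∀ u x, g u (gi u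 x) = x) → ∃ (A : ℝ → (EuclideanSpace ℝ (Fin 3) ≃ₗᵢ[ℝ] EuclideanSpace ℝ (Fin 3))) (H Hi : ℝ → Metric.sphere (0 : EuclideanSpace ℝ (Fin 2)) 1 → Metric.sphere (0 : EuclideanSpace ℝ (Fin 3)) 1 → Metric.sphere (0 : EuclideanSpace ℝ (Fin 3)) 1), ContDiff ℝ ∞ (fun t => (A t : EuclideanSpace ℝ (Fin 3) →L[ℝ] EuclideanSpace ℝ (Fin 3))) ∧ (∀ t, t ≤ 1 / 4 ∨ 3 / 4 ≤ t → A t = LinearIsometryEquiv.refl ℝ (EuclideanSpace ℝ (Fin 3))) ∧ ContMDiff (𝓘(ℝ, ℝ).prod ((𝓡 1).prod (𝓡 2))) (𝓡 2) ∞ (fun p : ℝ × (Metric.sphere (0 : EuclideanSpace ℝ (Fin 2)) 1 × Metric.sphere (0 : EuclideanSpace ℝ (Fin 3)) 1) => H p.1 p.2.1 p.2.2) ∧ ContMDiff (𝓘(ℝ, ℝ).prod ((𝓡 1).prod (𝓡 2))) (𝓡 2) ∞ (fun p : ℝ × (Metric.sphere (0 : EuclideanSpace ℝ (Fin 2)) 1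 × Metric.sphere (0 : EuclideanSpace ℝ (Fin 3)) 1) => Hi p.1 p.2.1 p.2.2) ∧ (∀ t u x, Hi t u (H t u x) = x) ∧ (∀ t u x, H t u (Hi t u x) = x) ∧ (∀ u x, H 0 u x = g (circlePt (Real.smoothTransition (2 * angA u - 1 / 2))) x) ∧ (∀ u x, H 1 u x = sphereCongr (A (angA u)) (g ptA x)) := by
  intro g gi hg hgi hgig hggi
  -- the slices at the base point
  have hg0 : ContMDiff (𝓡 2) (𝓡 2) ∞ (g ptA) := hg.comp (contMDiff_const.prodMk contMDiff_id)
  have hgi0 : ContMDiff (𝓡 2) (𝓡 2) ∞ (gi ptA) := hgi.comp (contMDiff_const.prodMk contMDiff_id)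
  have hST : ContMDiff 𝓘(ℝ, ℝ) 𝓘(ℝ, ℝ) ∞ Real.smoothTransition := Real.smoothTransition.contDiff.contMDiff
  have hcirc : ContMDiff 𝓘(ℝ, ℝ) (𝓡 1) ∞ fun s : ℝ => circlePt (Real.smoothTransition s) :=
    contMDiff_circlePt.comp hST
  have hpt0 : circlePt (Real.smoothTransition 0) = ptA := by
    rw [Real.smoothTransition.zero_of_nonpos le_rfl]; rfl
  have hpt1 : circlePt 1 = ptA := by
    have h := circlePt_add_one 0
    rw [zero_add] at h
    exact h
  -- the based loop as a diffeotopy of `S²`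
  set D : Diffeotopy (𝓡 2) (Metric.sphere (0 : EuclideanSpace ℝ (Fin 3)) 1) :=
    Diffeotopy.mk' (𝓡 2) (fun s x => g (circlePt (Real.smoothTransition s)) (gi ptA x))
      (fun s y => g ptA (gi (circlePt (Real.smoothTransition s)) y))
      (hg.comp ((hcirc.comp contMDiff_fst).prodMk (hgi0.comp contMDiff_snd)))
      (hg0.comp (hgi.comp ((hcirc.comp contMDiff_fst).prodMk contMDiff_snd)))
      (fun s x => by simp only [hgig, hggi])
      (fun s y => by simp only [hgig, hggi])
      (by funext x; simp only [hpt0, hggi, id]) with hD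
  have hDto : ∀ s x, D.toFun s x = g (circlePt (Real.smoothTransition s)) (gi ptA x) := fun s x => rfl
  have hD0 : ∀ s ≤ (0 : ℝ), D.toFun s = id := by
    intro s hs; funext x
    rw [hDto, Real.smoothTransition.zero_of_nonpos hs]
    show g ptA (gi ptA x) = x
    rw [hggi]
  have hD1 : ∀ s, (1 : ℝ) ≤ s → D.toFun s = id := by
    intro s hs; funext x
    rw [hDto, Real.smoothTransition.one_of_one_le hs, hpt1, hggi, id]
  obtain ⟨A, 𝒟, 𝒟i, hAs, hAflat, -, h𝒟, h𝒟i, h𝒟i𝒟, h𝒟𝒟i, h𝒟1, h𝒟0, h𝒟flat⟩ :=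
    exists_loopHomotopy_frameLoop_two D (sphereBasePoint 2) hD0 hD1
  have h𝒟iflat : ∀ σ s, s ≤ 0 ∨ 1 ≤ s → ∀ x, 𝒟i σ s x = x := by
    intro σ s hs x
    conv_lhs => rw [← h𝒟flat σ s hs x]
    exact h𝒟i𝒟 σ s x
  -- the reparametrised data
  have haff : ContDiff ℝ ∞ fun t : ℝ => 2 * t - 1 / 2 := (contDiff_const.mul contDiff_id).sub contDiff_const
  have hflat_aff : ∀ s : ℝ, s ≤ 1 / 4 ∨ 3 / 4 ≤ s → 2 * s - 1 / 2 ≤ 0 ∨ 1 ≤ 2 * s - 1 / 2 := by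
    rintro s (hs | hs)
    · left; linarith
    · right; linarith
  refine ⟨fun t => A (2 * t - 1 / 2),
    fun t u x => 𝒟 (1 - t) (2 * angA u - 1 / 2) (g ptA x),
    fun t u x => gi ptA (𝒟i (1 - t) (2 * angA u - 1 / 2) x), hAs.comp haff,
    fun t ht => hAflat _ (hflat_aff t ht), ?_, ?_, ?_, ?_, ?_, ?_⟩
  · -- joint smoothness of `H`, through `contMDiff_comp_angA`
    have c1 : ContMDiff (𝓘(ℝ, ℝ).prod (𝓘(ℝ, ℝ).prod ((𝓡 1).prod (𝓡 2)))) 𝓘(ℝ, ℝ) ∞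
        fun q : ℝ × (ℝ × (Metric.sphere (0 : EuclideanSpace ℝ (Fin 2)) 1 ×
          Metric.sphere (0 : EuclideanSpace ℝ (Fin 3)) 1)) => 1 - q.2.1 :=
      (contDiff_const.sub contDiff_id).comp_contMDiff (contMDiff_fst.comp contMDiff_snd)
    have c2 : ContMDiff (𝓘(ℝ, ℝ).prod (𝓘(ℝ, ℝ).prod ((𝓡 1).prod (𝓡 2)))) 𝓘(ℝ, ℝ) ∞
        fun q : ℝ × (ℝ × (Metric.sphere (0 : EuclideanSpace ℝ (Fin 2)) 1 ×
          Metric.sphere (0 : EuclideanSpace ℝ (Fin 3)) 1)) => 2 * q.1 - 1 / 2 :=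
      haff.comp_contMDiff contMDiff_fst
    have c3 : ContMDiff (𝓘(ℝ, ℝ).prod (𝓘(ℝ, ℝ).prod ((𝓡 1).prod (𝓡 2)))) (𝓡 2) ∞
        fun q : ℝ × (ℝ × (Metric.sphere (0 : EuclideanSpace ℝ (Fin 2)) 1 ×
          Metric.sphere (0 : EuclideanSpace ℝ (Fin 3)) 1)) => g ptA q.2.2.2 :=
      hg0.comp (contMDiff_snd.comp (contMDiff_snd.comp contMDiff_snd))
    have hK := h𝒟.comp (c1.prodMk (c2.prodMk c3))
    refine contMDiff_comp_angA
      (fun s (n : ℝ × (Metric.sphere (0 : EuclideanSpace ℝ (Fin 2)) 1 ×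
        Metric.sphere (0 : EuclideanSpace ℝ (Fin 3)) 1)) => 𝒟 (1 - n.1) (2 * s - 1 / 2) (g ptA n.2.2))
      (fun n => n.2.1) hK ?_ (contMDiff_fst.comp contMDiff_snd)
    intro s hs n
    show 𝒟 (1 - n.1) (2 * s - 1 / 2) (g ptA n.2.2) = 𝒟 (1 - n.1) (2 * 0 - 1 / 2) (g ptA n.2.2)
    rw [h𝒟flat _ _ (hflat_aff s hs), h𝒟flat _ _ (Or.inl (by norm_num))]
  · -- joint smoothness of `H⁻¹`
    have c1 : ContMDiff (𝓘(ℝ, ℝ).prod (𝓘(ℝ, ℝ).prod ((𝓡 1).prod (𝓡 2)))) 𝓘(ℝ, ℝ) ∞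
        fun q : ℝ × (ℝ × (Metric.sphere (0 : EuclideanSpace ℝ (Fin 2)) 1 ×
          Metric.sphere (0 : EuclideanSpace ℝ (Fin 3)) 1)) => 1 - q.2.1 :=
      (contDiff_const.sub contDiff_id).comp_contMDiff (contMDiff_fst.comp contMDiff_snd)
    have c2 : ContMDiff (𝓘(ℝ, ℝ).prod (𝓘(ℝ, ℝ).prod ((𝓡 1).prod (𝓡 2)))) 𝓘(ℝ, ℝ) ∞
        fun q : ℝ × (ℝ × (Metric.sphere (0 : EuclideanSpace ℝ (Fin 2)) 1 ×
          Metric.sphere (0 : EuclideanSpace ℝ (Fin 3)) 1)) => 2 * q.1 - 1 / 2 :=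
      haff.comp_contMDiff contMDiff_fst
    have c3 : ContMDiff (𝓘(ℝ, ℝ).prod (𝓘(ℝ, ℝ).prod ((𝓡 1).prod (𝓡 2)))) (𝓡 2) ∞
        fun q : ℝ × (ℝ × (Metric.sphere (0 : EuclideanSpace ℝ (Fin 2)) 1 ×
          Metric.sphere (0 : EuclideanSpace ℝ (Fin 3)) 1)) => q.2.2.2 :=
      contMDiff_snd.comp (contMDiff_snd.comp contMDiff_snd)
    have hK := hgi0.comp (h𝒟i.comp (c1.prodMk (c2.prodMk c3)))
    refine contMDiff_comp_angA
      (fun s (n : ℝ × (Metric.sphere (0 : EuclideanSpace ℝ (Fin 2)) 1 ×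
        Metric.sphere (0 : EuclideanSpace ℝ (Fin 3)) 1)) => gi ptA (𝒟i (1 - n.1) (2 * s - 1 / 2) n.2.2))
      (fun n => n.2.1) hK ?_ (contMDiff_fst.comp contMDiff_snd)
    intro s hs n
    show gi ptA (𝒟i (1 - n.1) (2 * s - 1 / 2) n.2.2) = gi ptA (𝒟i (1 - n.1) (2 * 0 - 1 / 2) n.2.2)
    rw [h𝒟iflat _ _ (hflat_aff s hs), h𝒟iflat _ _ (Or.inl (by norm_num))]
  · intro t u x
    show gi ptA (𝒟i (1 - t) (2 * angA u - 1 / 2) (𝒟 (1 - t) (2 * angA u - 1 / 2) (g ptA x))) = x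
    rw [h𝒟i𝒟, hgig]
  · intro t u x
    show 𝒟 (1 - t) (2 * angA u - 1 / 2) (g ptA (gi ptA (𝒟i (1 - t) (2 * angA u - 1 / 2) x))) = x
    rw [hggi, h𝒟𝒟i]
  · intro u x
    show 𝒟 (1 - 0) (2 * angA u - 1 / 2) (g ptA x) = _
    rw [sub_zero, h𝒟1, hDto, hgig]
  · intro u x
    show 𝒟 (1 - 1) (2 * angA u - 1 / 2) (g ptA x) = _
    rw [sub_self, h𝒟0]

/-! ### Step (c): Smale's theorem at `π₀` — the base diffeomorphism deforms to an isometry -/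

/-- **Step (c): the base diffeomorphism deforms to a linear isometry, uniformly along a circle
of rotations.**  For a diffeomorphism `g₀` of `S²` (given with its inverse) and a smooth loop `A`
of linear isometries, `1` off `(1/4, 3/4)`: by Smale (1959) — Cerf 1968, Appendice §5, Cor. 2 at
`i = 0`, the tree's `Diffeomorph.isDiffeotopicToId_or_isDiffeotopic_sphereReflection_two` —
`g₀ = E₁ ∘ L|S²` for a diffeotopy `E` of `S²` and `L ∈ {1, reflection}`; then
`H_t u := A(angA u) ∘ E_{1-t} ∘ L|S²` is a jointly smooth path of families (rotations act by the
diffeotopy `Diffeotopy.ofLinearIsometryFamily`; descent to the circle by `contMDiff_comp_angA`)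
from `u ↦ A(angA u) ∘ g₀` to `u ↦ A(angA u) ∘ L|S²`.
[cite: CerfDiffeoSphere1968, Appendice §5, Corollaire 2] -/
theorem exists_path_smale
    (g₀ g₀i : Metric.sphere (0 : EuclideanSpace ℝ (Fin 3)) 1 → Metric.sphere (0 : EuclideanSpace ℝ (Fin 3)) 1)
    (hg₀ : ContMDiff (𝓡 2) (𝓡 2) ∞ g₀) (hg₀i : ContMDiff (𝓡 2) (𝓡 2) ∞ g₀i)
    (hl : ∀ x, g₀i (g₀ x) = x) (hr : ∀ x, g₀ (g₀i x) = x)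
    (A : ℝ → (EuclideanSpace ℝ (Fin 3) ≃ₗᵢ[ℝ] EuclideanSpace ℝ (Fin 3)))
    (hA : ContDiff ℝ ∞ fun t => (A t : EuclideanSpace ℝ (Fin 3) →L[ℝ] EuclideanSpace ℝ (Fin 3)))
    (hAflat : ∀ t, t ≤ 1 / 4 ∨ 3 / 4 ≤ t → A t = LinearIsometryEquiv.refl ℝ (EuclideanSpace ℝ (Fin 3))) :
    ∃ (L : EuclideanSpace ℝ (Fin 3) ≃ₗᵢ[ℝ] EuclideanSpace ℝ (Fin 3))
      (H Hi : ℝ → Metric.sphere (0 : EuclideanSpace ℝ (Fin 2)) 1 → Metric.sphere (0 : EuclideanSpace ℝ (Fin 3)) 1 →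
        Metric.sphere (0 : EuclideanSpace ℝ (Fin 3)) 1),
      ContMDiff (𝓘(ℝ, ℝ).prod ((𝓡 1).prod (𝓡 2))) (𝓡 2) ∞
        (fun p : ℝ × (Metric.sphere (0 : EuclideanSpace ℝ (Fin 2)) 1 × Metric.sphere (0 : EuclideanSpace ℝ (Fin 3)) 1) =>
          H p.1 p.2.1 p.2.2) ∧
      ContMDiff (𝓘(ℝ, ℝ).prod ((𝓡 1).prod (𝓡 2))) (𝓡 2) ∞
        (fun p : ℝ × (Metric.sphere (0 : EuclideanSpace ℝ (Fin 2)) 1 × Metric.sphere (0 : EuclideanSpace ℝ (Fin 3)) 1) =>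
          Hi p.1 p.2.1 p.2.2) ∧
      (∀ t u x, Hi t u (H t u x) = x) ∧ (∀ t u x, H t u (Hi t u x) = x) ∧
      (∀ u x, H 0 u x = sphereCongr (A (angA u)) (g₀ x)) ∧
      (∀ u x, H 1 u x = sphereCongr (A (angA u)) (sphereCongr L x)) := by
  haveI := fact_finrank_euclideanSpace_succ 2
  set G₀ : Metric.sphere (0 : EuclideanSpace ℝ (Fin 3)) 1 ≃ₘ⟮𝓡 2, 𝓡 2⟯
      Metric.sphere (0 : EuclideanSpace ℝ (Fin 3)) 1 := ⟨⟨g₀, g₀i, hl, hr⟩, hg₀, hg₀i⟩ with hG₀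
  have hG₀apply : ∀ x, G₀ x = g₀ x := fun x => rfl
  -- Smale: `g₀ = E₁ ∘ L|S²`
  obtain ⟨L, E, hE⟩ : ∃ (L : EuclideanSpace ℝ (Fin 3) ≃ₗᵢ[ℝ] EuclideanSpace ℝ (Fin 3))
      (E : Diffeotopy (𝓡 2) (Metric.sphere (0 : EuclideanSpace ℝ (Fin 3)) 1)),
      ∀ x, E.toFun 1 (sphereCongr L x) = g₀ x := by
    rcases Diffeomorph.isDiffeotopicToId_or_isDiffeotopic_sphereReflection_two (sphereBasePoint 2) G₀
      with ⟨E, hE1⟩ | h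
    · refine ⟨LinearIsometryEquiv.refl ℝ _, E, fun x => ?_⟩
      have hx : sphereCongr (LinearIsometryEquiv.refl ℝ (EuclideanSpace ℝ (Fin 3))) x = x := Subtype.ext rfl
      rw [hx, ← Diffeotopy.coe_stage, hE1, hG₀apply]
    · rw [Diffeomorph.isDiffeotopic_iff] at h
      obtain ⟨E, hE1⟩ := h
      refine ⟨(ℝ ∙ ((sphereBasePoint 2 : Metric.sphere (0 : EuclideanSpace ℝ (Fin 3)) 1) :
        EuclideanSpace ℝ (Fin 3)))ᗮ.reflection, E, fun x => ?_⟩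
      rw [← sphereReflection_eq_sphereCongr, ← Diffeotopy.coe_stage, hE1, Diffeomorph.coe_trans,
        comp_apply, Diffeomorph.symm_apply_apply, hG₀apply]
  -- the rotations as a diffeotopy
  obtain ⟨DA, hDAto, hDAinv⟩ := exists_diffeotopy_sphereCongr A hA (hAflat 0 (Or.inl (by norm_num)))
  have hDAflat : ∀ s, s ≤ 1 / 4 ∨ 3 / 4 ≤ s → ∀ y, DA.toFun s y = y := by
    intro s hs y
    rw [hDAto, hAflat s hs]
    exact Subtype.ext rfl
  have hDAiflat : ∀ s, s ≤ 1 / 4 ∨ 3 / 4 ≤ s → ∀ y, DA.invFun s y = y := by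
    intro s hs y
    conv_lhs => rw [← hDAflat s hs y]
    exact DA.invFun_toFun s y
  refine ⟨L, fun t u x => DA.toFun (angA u) (E.toFun (1 - t) (sphereCongr L x)),
    fun t u x => (sphereCongr L).symm (E.invFun (1 - t) (DA.invFun (angA u) x)), ?_, ?_, ?_, ?_, ?_, ?_⟩
  · have c1 : ContMDiff (𝓘(ℝ, ℝ).prod (𝓘(ℝ, ℝ).prod ((𝓡 1).prod (𝓡 2)))) 𝓘(ℝ, ℝ) ∞
        fun q : ℝ × (ℝ × (Metric.sphere (0 : EuclideanSpace ℝ (Fin 2)) 1 ×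
          Metric.sphere (0 : EuclideanSpace ℝ (Fin 3)) 1)) => 1 - q.2.1 :=
      (contDiff_const.sub contDiff_id).comp_contMDiff (contMDiff_fst.comp contMDiff_snd)
    have c3 : ContMDiff (𝓘(ℝ, ℝ).prod (𝓘(ℝ, ℝ).prod ((𝓡 1).prod (𝓡 2)))) (𝓡 2) ∞
        fun q : ℝ × (ℝ × (Metric.sphere (0 : EuclideanSpace ℝ (Fin 2)) 1 ×
          Metric.sphere (0 : EuclideanSpace ℝ (Fin 3)) 1)) => sphereCongr L q.2.2.2 :=
      (sphereCongr L).contMDiff.comp (contMDiff_snd.comp (contMDiff_snd.comp contMDiff_snd))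
    have hK := DA.contMDiff_uncurry_toFun.comp
      (contMDiff_fst.prodMk (E.contMDiff_uncurry_toFun.comp (c1.prodMk c3)))
    refine contMDiff_comp_angA
      (fun s (n : ℝ × (Metric.sphere (0 : EuclideanSpace ℝ (Fin 2)) 1 ×
        Metric.sphere (0 : EuclideanSpace ℝ (Fin 3)) 1)) => DA.toFun s (E.toFun (1 - n.1) (sphereCongr L n.2.2)))
      (fun n => n.2.1) hK ?_ (contMDiff_fst.comp contMDiff_snd)
    intro s hs n
    show DA.toFun s (E.toFun (1 - n.1) (sphereCongr L n.2.2)) = DA.toFun 0 (E.toFun (1 - n.1) (sphereCongr L n.2.2))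
    rw [hDAflat s hs, hDAflat 0 (Or.inl (by norm_num))]
  · have c1 : ContMDiff (𝓘(ℝ, ℝ).prod (𝓘(ℝ, ℝ).prod ((𝓡 1).prod (𝓡 2)))) 𝓘(ℝ, ℝ) ∞
        fun q : ℝ × (ℝ × (Metric.sphere (0 : EuclideanSpace ℝ (Fin 2)) 1 ×
          Metric.sphere (0 : EuclideanSpace ℝ (Fin 3)) 1)) => 1 - q.2.1 :=
      (contDiff_const.sub contDiff_id).comp_contMDiff (contMDiff_fst.comp contMDiff_snd)
    have c3 : ContMDiff (𝓘(ℝ, ℝ).prod (𝓘(ℝ, ℝ).prod ((𝓡 1).prod (𝓡 2)))) (𝓡 2) ∞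
        fun q : ℝ × (ℝ × (Metric.sphere (0 : EuclideanSpace ℝ (Fin 2)) 1 ×
          Metric.sphere (0 : EuclideanSpace ℝ (Fin 3)) 1)) => DA.invFun q.1 q.2.2.2 :=
      DA.contMDiff_uncurry_invFun.comp (contMDiff_fst.prodMk (contMDiff_snd.comp (contMDiff_snd.comp contMDiff_snd)))
    have hK := (sphereCongr L).symm.contMDiff.comp (E.contMDiff_uncurry_invFun.comp (c1.prodMk c3))
    refine contMDiff_comp_angA
      (fun s (n : ℝ × (Metric.sphere (0 : EuclideanSpace ℝ (Fin 2)) 1 ×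
        Metric.sphere (0 : EuclideanSpace ℝ (Fin 3)) 1)) =>
          (sphereCongr L).symm (E.invFun (1 - n.1) (DA.invFun s n.2.2)))
      (fun n => n.2.1) hK ?_ (contMDiff_fst.comp contMDiff_snd)
    intro s hs n
    show (sphereCongr L).symm (E.invFun (1 - n.1) (DA.invFun s n.2.2)) =
      (sphereCongr L).symm (E.invFun (1 - n.1) (DA.invFun 0 n.2.2))
    rw [hDAiflat s hs, hDAiflat 0 (Or.inl (by norm_num))]
  · intro t u x
    show (sphereCongr L).symm (E.invFun (1 - t) (DA.invFun (angA u)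
      (DA.toFun (angA u) (E.toFun (1 - t) (sphereCongr L x))))) = x
    rw [DA.invFun_toFun, E.invFun_toFun, Diffeomorph.symm_apply_apply]
  · intro t u x
    show DA.toFun (angA u) (E.toFun (1 - t) (sphereCongr L ((sphereCongr L).symm
      (E.invFun (1 - t) (DA.invFun (angA u) x))))) = x
    rw [Diffeomorph.apply_symm_apply, E.toFun_invFun, DA.toFun_invFun]
  · intro u x
    show DA.toFun (angA u) (E.toFun (1 - 0) (sphereCongr L x)) = _
    rw [sub_zero, hE, hDAto]
  · intro u x
    show DA.toFun (angA u) (E.toFun (1 - 1) (sphereCongr L x)) = _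
    rw [sub_self, E.toFun_zero, id, hDAto]

end Summit.SmoothPoincare4.SmoothPoincare4.Cruxes.RungOne.Sketch

end
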